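import Summits.CriticalPhenomena.PercolationContinuityZ3.Theorems.PercNearOneGluingNoHeavyQuantSliceSingleLayerReduction
import Summits.CriticalPhenomena.PercolationContinuityZ3.Theorems.PercNearOneGluingNoHeavyQuantLowToZeroMove
import HarnessLib

/-!
# QUANT lane R8, T-DEC, leg (III), blob case — dual route, part 2: NO WEAK MID ⟹ the price inequality by single-layer weak duality
# (the zero re-priced up to `α 0`; uses `z ≤ ν 0`)

builds on p205010 (kernel theorem, internal audit signed; external expert review pending)

Support file (`--supports stmt-CriticalPhenomena-4575`), QUANT lane typer seat prim-quant-stmt (gen 29), rung R8 of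
`run/shared/lean/prim/quant/LADDER.md`.  Theorems only, standard axioms, no sorries, no definitions.  Part 1: `…QuantGatedSliceWindowLayer`
(`slicePullback_layer`); statements: `…QuantGatedSliceWindow`.

THE STEP (memo GATED-SLICE-DUAL-G29 §2).  Frame of `GatedSliceWindowDEC`; `(α, β)` a price system of the moved law's positions at
`(y, t, j)`, `t = T₀ + ag`, `T₀ = S − zag ≤ S`, normalised so that `α 0 ≥ 0` dominates the price of the atom `a`; `Φ = slicePullback t g j a α β`.
At a layer `J ≤ M` where (i) `Φ ≤ 0` off the `T₀`-lows, (ii) the `T₀`-low conditions hold, (iii) every atom `h ∈ (J, M]` gives the zero the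
giant credit `α 0 ≤ u·(−Φ h)`, and (iv) NO MID IS WEAK — `α 0·(h − S) ≤ S·(−Φ h)` for every `h ≤ J` with `S < h` — the functional `Φ` with the
zero RE-PRICED to `α 0` is dominated by a price system of `ν` at `(y, S, J)`: lows keep `Φ` (rates only grow from `T₀` to `S`,
`usage_le_of_target_le`; class-change atoms have `Φ ≤ 0`), absorbers get credit `−Φ`, the zero reaches every `J`-giant at `u` and every mid
`h > S` at `usage ≥ S/(h − S)` (`usage_mid_eq`).  Weak duality (`dual_le_of_decAtT`) gives `Σ_k Φ k ν k + (α 0 − Φ 0)·ν 0 ≤ 0`, and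
`α 0 − Φ 0 = g(α 0 − e a) ≥ 0` with `z ≤ ν 0` turns this into **`Σ_k Φ k ν k + g z (α 0 − e a) ≤ 0`** — the value of `(α,β)` on the moved law.

* **`LawDec.gatedSlice_noWeak_functional_le`** — the displayed inequality under (i)–(iv).

[this work]; single-layer machinery: census-2 g54–g55, typer g24/g28 (this lane).  The gluing rows served [cite: KozmaNitzan2024, Conjecture 3
(p. 15)]; product measure [cite: Grimmett1999, §1.3 p. 10].
-/

noncomputable section

namespace Summit.CriticalPhenomena.PercolationContinuityZ3.Theorems

namespace Quant

open Finset

namespace LawDec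

/-- **NO WEAK MID ⟹ THE FUNCTIONAL INEQUALITY AT LAYER `J`.**  See the file header: `ν` with `z ≤ ν 0`, DEC at `(y, S, J)`
(`0 < y < 1`, `0 ≤ g`, `0 < S`, `T₀ ≤ S`, `0 < T₀ + ag`, `J ≤ M`); `Φ = slicePullback (T₀ + ag) g j a α β` with
`coefAt (T₀+ag) j α β a ≤ α 0`; conditions (i)–(iv).  Then `Σ_{k ≤ M} Φ k · ν k + g z (α 0 − coefAt (T₀+ag) j α β a) ≤ 0`. [this work] -/
theorem gatedSlice_noWeak_functional_le (y z g S T₀ : ℝ) (a j M J : ℕ) (ν α β : ℕ → ℝ)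
    (hy0 : 0 < y) (hy1 : y < 1) (hzν : z ≤ ν 0) (hg0 : 0 ≤ g) (hS0 : 0 < S) (hT₀S : T₀ ≤ S)
    (ht0 : 0 < T₀ + (a : ℝ) * g) (hJM : J ≤ M)
    (hdec : DECAtT y S J M ν)
    (hαa : coefAt (T₀ + (a : ℝ) * g) j α β a ≤ α 0)
    (habs : ∀ h, h ≤ M → ¬ (h ≤ J ∧ 2 * (h : ℝ) < T₀) → slicePullback (T₀ + (a : ℝ) * g) g j a α β h ≤ 0)
    (hlow : ∀ l h, l ≤ J → 2 * (l : ℝ) < T₀ → h ≤ M → (J + 1 ≤ h ∨ T₀ < (l : ℝ) + h) →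
      slicePullback (T₀ + (a : ℝ) * g) g j a α β l
        ≤ usage y T₀ J l h * (- slicePullback (T₀ + (a : ℝ) * g) g j a α β h))
    (hgiant : ∀ h, J + 1 ≤ h → h ≤ M → α 0 ≤ y / (1 - y) * (- slicePullback (T₀ + (a : ℝ) * g) g j a α β h))
    (hnoweak : ∀ h : ℕ, h ≤ J → h ≤ M → S < (h : ℝ) →
      α 0 * ((h : ℝ) - S) ≤ S * (- slicePullback (T₀ + (a : ℝ) * g) g j a α β h)) :
    ∑ k ∈ Finset.range (M + 1), slicePullback (T₀ + (a : ℝ) * g) g j a α β k * ν k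
      + g * z * (α 0 - coefAt (T₀ + (a : ℝ) * g) j α β a) ≤ 0 := by
  classical
  set t : ℝ := T₀ + (a : ℝ) * g with ht
  set Φ : ℕ → ℝ := slicePullback t g j a α β with hΦ
  -- an S-absorber below M is a T₀-absorber, so Φ ≤ 0 there
  have habsS : ∀ k, k ≤ M → ¬ (k ≤ J ∧ 2 * (k : ℝ) < S) → Φ k ≤ 0 := by
    intro k hk hnl
    refine habs k hk (fun hc => hnl ⟨hc.1, ?_⟩)
    linarith [hc.2]
  -- the price system of ν at (S, J): absorbers credited −Φ, lows priced Φ, the zero re-priced to α 0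
  set β' : ℕ → ℝ := fun k => if k ≤ J ∧ 2 * (k : ℝ) < S then 0 else (if k ≤ M then - Φ k else 0) with hβ'
  set α' : ℕ → ℝ := fun k => if k = 0 then α 0 else Φ k with hα'
  have hβ'eq : ∀ k, k ≤ M → ¬ (k ≤ J ∧ 2 * (k : ℝ) < S) → β' k = - Φ k := by
    intro k hk hnl; simp only [hβ', if_neg hnl, if_pos hk]
  have hβ'0 : ∀ k, 0 ≤ β' k := by
    intro k
    by_cases hc : k ≤ J ∧ 2 * (k : ℝ) < S
    · simp only [hβ', if_pos hc]; exact le_rfl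
    · by_cases hkM : k ≤ M
      · rw [hβ'eq k hkM hc]; linarith [habsS k hkM hc]
      · simp only [hβ', if_neg hc, if_neg hkM]; exact le_rfl
  -- validity of (α', β') at (y, S, J)
  have hαβ' : ∀ l h, l ≤ J → 2 * (l : ℝ) < S → h ≤ M → (J + 1 ≤ h ∨ S < (l : ℝ) + h) → α' l ≤ usage y S J l h * β' h := by
    intro l h hlJ hlowS hhM hcomp
    have hlh : l < h := by
      rcases hcomp with hc | hc
      · omega
      · have : (l : ℝ) < h := by linarith
        exact_mod_cast this
    have hnl : ¬ (h ≤ J ∧ 2 * (h : ℝ) < S) := by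
      rintro ⟨h1, h2⟩
      rcases hcomp with hc | hc
      · omega
      · have : (l : ℝ) < h := by exact_mod_cast hlh
        linarith
    rw [hβ'eq h hhM hnl]
    have hcred : 0 ≤ - Φ h := by linarith [habsS h hhM hnl]
    have hupos : 0 < usage y S J l h := usage_pos_of_compat y S J l h hy0 hy1 hlowS hlh hcomp
    by_cases hl0 : l = 0
    · -- the zero: giants at rate u, mids at rate ≥ S/(h − S)
      subst hl0
      have e0 : α' 0 = α 0 := by simp only [hα', if_pos rfl]
      rw [e0]
      by_cases hgi : J + 1 ≤ h
      · rw [usage_giant_eq y S J 0 h hgi]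
        exact hgiant h hgi hhM
      · have hhJ : h ≤ J := by omega
        have hSh : S < (h : ℝ) := by
          rcases hcomp with hc | hc
          · omega
          · simpa using hc
        have hw := hnoweak h hhJ hhM hSh
        have hd : 0 < (h : ℝ) - S := by linarith
        -- usage ≥ S/(h − S)
        have hu : S / ((h : ℝ) - S) ≤ usage y S J 0 h := by
          rw [usage_mid_eq y S J 0 h hy0 hy1 hhJ (by simpa using hS0) (by simpa using hSh)]
          have e1 : (S - 2 * ((0 : ℕ) : ℝ)) / (((0 : ℕ) : ℝ) + h - S) = S / ((h : ℝ) - S) := by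
            simp only [Nat.cast_zero, mul_zero, sub_zero, zero_add]
          rw [← e1]
          exact le_max_left _ _
        have h1 : α 0 ≤ S / ((h : ℝ) - S) * (- Φ h) := by
          rw [div_mul_eq_mul_div, le_div_iff₀ hd]
          linarith
        exact h1.trans (mul_le_mul_of_nonneg_right hu hcred)
    · -- a nonzero low: Φ-priced
      have el : α' l = Φ l := by simp only [hα', if_neg hl0]
      rw [el]
      by_cases hlT : 2 * (l : ℝ) < T₀
      · -- a T₀-low: rates grow from T₀ to S
        have hcompT : J + 1 ≤ h ∨ T₀ < (l : ℝ) + h := by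
          rcases hcomp with hc | hc
          · exact Or.inl hc
          · exact Or.inr (by linarith)
        have h1 := hlow l h hlJ hlT hhM hcompT
        have h2 : usage y T₀ J l h ≤ usage y S J l h :=
          usage_le_of_target_le y T₀ S J l h hy0 hy1 hT₀S hlT hlh hcomp
        exact h1.trans (mul_le_mul_of_nonneg_right h2 hcred)
      · -- a class-change atom: Φ l ≤ 0
        have h1 : Φ l ≤ 0 := habs l (by omega) (fun hc => hlT hc.2)
        have : 0 ≤ usage y S J l h * (- Φ h) := mul_nonneg hupos.le hcred
        linarith
  -- weak duality at (S, J)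
  have wd := dual_le_of_decAtT y S J M ν hy0 hy1 hdec α' β' hβ'0 hαβ'
  have wd_eq := dual_functional_eq S J M α' β' ν hJM
  -- the coefficients: Φ everywhere, plus (α 0 − Φ 0) at the zero
  have hcoef : ∀ p ∈ Finset.range (M + 1),
      coefAt S J α' β' p * ν p = Φ p * ν p + (if p = 0 then (α 0 - Φ 0) * ν 0 else 0) := by
    intro p hp
    have hpM : p ≤ M := Nat.lt_succ_iff.1 (Finset.mem_range.1 hp)
    unfold coefAt
    by_cases hpl : p ≤ J ∧ 2 * (p : ℝ) < S
    · rw [if_pos hpl]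
      by_cases hp0 : p = 0
      · subst hp0
        simp only [hα', if_pos rfl, if_true]
        ring
      · simp only [hα', if_neg hp0]
        ring
    · rw [if_neg hpl, hβ'eq p hpM hpl]
      have hp0 : p ≠ 0 := by
        rintro rfl
        exact hpl ⟨Nat.zero_le J, by simpa using hS0⟩
      rw [if_neg hp0]
      ring
  rw [Finset.sum_congr rfl hcoef, Finset.sum_add_distrib, Finset.sum_ite_eq' (Finset.range (M + 1)) 0
    (fun _ => (α 0 - Φ 0) * ν 0), if_pos (Finset.mem_range.2 (Nat.succ_pos M))] at wd_eq
  -- Φ 0 = (1 − g)·α 0 + g·e a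
  have hΦ0 : Φ 0 = (1 - g) * α 0 + g * coefAt t j α β a := by
    simp only [hΦ, slicePullback, zero_add]
    unfold coefAt
    rw [if_pos ⟨Nat.zero_le j, by simpa using ht0⟩]
  -- assemble
  have hmain : ∑ k ∈ Finset.range (M + 1), Φ k * ν k + (α 0 - Φ 0) * ν 0 ≤ 0 := by linarith [wd, wd_eq]
  have hκ : 0 ≤ g * (α 0 - coefAt t j α β a) := mul_nonneg hg0 (by linarith)
  have hzz : g * z * (α 0 - coefAt t j α β a) ≤ (α 0 - Φ 0) * ν 0 := by
    rw [hΦ0]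
    nlinarith [mul_le_mul_of_nonneg_left hzν hκ]
  linarith

end LawDec

end Quant

end Summit.CriticalPhenomena.PercolationContinuityZ3.Theorems
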